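import Literature.Geometry.GeometricMeasureTheory.Currents
import Mathlib.Analysis.Distribution.AEEqOfIntegralContDiff
import Mathlib.Topology.MetricSpace.HausdorffDimension
import HarnessLib

/-!
# Federer's support theorem for integral flat chains, I: currents with null support

This file starts the proof of the named fact
`Literature.Geometry.GeometricMeasureTheory.Federer1969_support_integralFlatChain`
(`Currents.lean`): an integral flat chain `T = R + ∂S` of positive dimension `m + 1` in an open
subset `Ω` of a finite-dimensional real inner product space `V`, whose support is `𝓗^{m+1}`-null,
vanishes [Federer, *Geometric Measure Theory*, 4.1.20, for the subgroup `𝓕 ⊆ 𝐅` of 4.1.24 and with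
`𝓗` for `𝓘`].

Federer's proof (4.1.20, PDF pp. 319–320 of the held copy): write every test form as
`φ = Σ_λ φ_λ ∧ 𝐩_λ^#(DY₁ ∧ ⋯ ∧ DY_m)` with the coordinate projections `𝐩_λ : ℝⁿ → ℝᵐ`, so that
`T(φ) = Σ_λ 𝐩_λ#(T ⌞ φ_λ)(DY₁ ∧ ⋯ ∧ DY_m)`, and observe that each `𝐩_λ#(T ⌞ φ_λ)` is a
top-dimensional flat chain of `ℝᵐ` supported in the Lebesgue-null set `𝐩_λ(spt T)`, hence `0` by
4.1.18 (`𝐅_m(ℝᵐ) = {ℒᵐ ∧ f : f ∈ L¹_loc}`). For the integral flat chains of `Currents.lean`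
(`R`, `S` currents of integration over countably rectifiable sets with tangent orthonormal frames)
the rôle of 4.1.18 is played by the absolute continuity, with respect to `ℒᵐ`, of the push-forward
under `𝐩_λ` of the measures `θ φ_λ det(𝐩_λ ∘ ξ) 𝓗ᵐ ⌞ W` and `θ' (dφ_λ ∧ 𝐩_λ^# ω)(ξ') 𝓗^{m+1} ⌞ W'`,
which rests on the structure theory of rectifiable sets (Federer 3.2.16–3.2.22). That part is
carried out in the sibling files; the present file contains the first, measure-theoretic step:

* `vectorCurrent_eq_zero_of_measure_support_eq_zero`: a current representable by integration,
  `μ ∧ η`, whose support is `μ`-null is the zero current (the density of a current representable by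
  integration vanishes almost everywhere off the support; Federer 4.1.5, 4.1.7, with the
  fundamental lemma of the calculus of variations, Mathlib's
  `IsOpen.ae_eq_zero_of_integral_contDiff_smul_eq_zero`);
* `Current.IsLocallyRectifiable.eq_zero_of_measure_support_eq_zero`: hence a locally rectifiable
  current `(𝓗ᵐ ⌞ W) ∧ θ ξ` with `𝓗ᵐ`-null support vanishes — the case `S = 0` of 4.1.20 for `𝓕_m`;
* `Federer1969_support_integralFlatChain_of_finrank_le`: the support theorem in codimension `≤ 0`,
  i.e. when `dim V ≤ m + 1`: then `𝓗^{m+2} = 0` on `V`, so every rectifiable `(m+2)`-current `S`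
  is `0` and `T = R` is locally rectifiable.

## References

* H. Federer, *Geometric Measure Theory*, Springer 1969, 4.1.20 (support theorem), 4.1.18, 4.1.24,
  4.1.28; held copy `lit book:federernd-geometric-measure-theory`, PDF pp. 319–320.
-/

open scoped Distributions ENNReal NNReal Topology
open MeasureTheory TopologicalSpace Set Filter

namespace Literature.Geometry.GeometricMeasureTheory

set_option maxSynthPendingDepth 2

section VectorCurrent

variable {V : Type*} [NormedAddCommGroup V] [NormedSpace ℝ V] [FiniteDimensional ℝ V]
  [MeasurableSpace V] [BorelSpace V] {Ω : Opens V} {m : ℕ}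

/-- **The density of `μ ∧ η` vanishes almost everywhere off the support.** If `η` is locally
`μ`-integrable on `Ω`, then `η = 0` for `μ`-a.e. point of `Ω ∖ spt (μ ∧ η)` ("‖T‖(U ∼ spt T) = 0"
for currents representable by integration). [cite: Federer1969, 4.1.5 and 4.1.7] -/
theorem ae_eq_zero_of_mem_sdiff_support_vectorCurrent {μ : Measure V} {η : V → Multivector V m}
    (hη : LocallyIntegrableOn η (Ω : Set V) μ) :
    ∀ᵐ y ∂μ, y ∈ (Ω : Set V) \ (vectorCurrent μ η : Current Ω m).support → η y = 0 := by
  set T : Current Ω m := vectorCurrent μ η with hT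
  -- locally, off the support, the density vanishes a.e. (fundamental lemma)
  have key : ∀ x ∈ (Ω : Set V) \ T.support,
      ∃ U : Set V, IsOpen U ∧ x ∈ U ∧ ∀ᵐ y ∂μ, y ∈ U → η y = 0 := by
    rintro x ⟨hxΩ, hxT⟩
    obtain ⟨U, hU, hTU⟩ := T.exists_nhds_of_not_mem_support hxΩ hxT
    obtain ⟨U', hU'sub, hU'open, hxU'⟩ :=
      mem_nhds_iff.1 (inter_mem hU (Ω.isOpen.mem_nhds hxΩ))
    have hU'Ω : U' ⊆ (Ω : Set V) := fun y hy => (hU'sub hy).2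
    have hU'U : U' ⊆ U := fun y hy => (hU'sub hy).1
    refine ⟨U', hU'open, hxU', ?_⟩
    refine hU'open.ae_eq_zero_of_integral_contDiff_smul_eq_zero (hη.mono_set hU'Ω) ?_
    intro g hg hgs hgU'
    -- the vector `∫ g • η dμ ∈ Multivector V m` vanishes: test it against every covector `c`
    have hint : Integrable (fun y => g y • η y) μ := by
      have := TestFunction.integrable_bilin (ContinuousLinearMap.lsmul ℝ ℝ) hη
        (⟨g, hg, hgs, hgU'.trans hU'Ω⟩ : 𝓓(Ω, ℝ))
      simpa using this
    refine ContinuousLinearMap.ext fun c => ?_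
    rw [ContinuousLinearMap.integral_apply hint c, zero_apply]
    -- the test form `y ↦ g y • c` (Federer's `φ_λ ∧ (constant covector)`)
    let ψ : TestForm Ω m := TestFunction.mk (fun y => g y • c) (hg.smul contDiff_const)
      (hgs.mono fun y (hy : g y • c ≠ 0) (h0 : g y = 0) => hy (by rw [h0, zero_smul]))
      ((tsupport_smul_subset_left _ _).trans (hgU'.trans hU'Ω))
    have h1 : T ψ = 0 := hTU _ ((tsupport_smul_subset_left _ _).trans (hgU'.trans hU'U))
    rw [hT, vectorCurrent_apply hη] at h1
    simpa [ψ] using h1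
  -- a countable subfamily of these neighbourhoods covers `Ω ∖ spt T`
  choose! U hUo hxU hU using key
  obtain ⟨t, htG, htc, hcover⟩ := TopologicalSpace.countable_cover_nhdsWithin
    (f := U) (s := (Ω : Set V) \ T.support)
    (fun x hx => mem_nhdsWithin_of_mem_nhds ((hUo x hx).mem_nhds (hxU x hx)))
  have hall : ∀ᵐ y ∂μ, ∀ x ∈ t, y ∈ U x → η y = 0 :=
    (ae_ball_iff htc).2 fun x hx => hU x (htG hx)
  filter_upwards [hall] with y hy hyG
  obtain ⟨x, hxt, hyx⟩ := mem_iUnion₂.1 (hcover hyG)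
  exact hy x hxt hyx

/-- **A current representable by integration with null support vanishes**: if
`μ (spt (μ ∧ η)) = 0` then `μ ∧ η = 0` (for `η` not locally integrable `μ ∧ η` is the zero current
by convention). This is "‖T‖ is concentrated on spt T and ‖T‖ ≪ μ" for `T = μ ∧ η`.
[cite: Federer1969, 4.1.5 and 4.1.7] -/
theorem vectorCurrent_eq_zero_of_measure_support_eq_zero {μ : Measure V}
    {η : V → Multivector V m} (h0 : μ (vectorCurrent μ η : Current Ω m).support = 0) :
    (vectorCurrent μ η : Current Ω m) = 0 := by
  by_cases hη : LocallyIntegrableOn η (Ω : Set V) μ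
  swap
  · exact vectorCurrent_of_not_locallyIntegrableOn hη
  have hG := ae_eq_zero_of_mem_sdiff_support_vectorCurrent (m := m) hη
  ext φ
  rw [vectorCurrent_apply hη, zero_apply]
  refine integral_eq_zero_of_ae ?_
  filter_upwards [hG, measure_eq_zero_iff_ae_notMem.1 h0] with y hyG hyT
  change η y (φ y) = 0
  by_cases hyΩ : y ∈ (Ω : Set V)
  · rw [hyG ⟨hyΩ, hyT⟩, zero_apply]
  · have : φ y = 0 := image_eq_zero_of_notMem_tsupport fun h => hyΩ (φ.tsupport_subset h)
    rw [this, map_zero]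

end VectorCurrent

section Rectifiable

variable {V : Type*} [NormedAddCommGroup V] [InnerProductSpace ℝ V] [FiniteDimensional ℝ V]
  [MeasurableSpace V] [BorelSpace V] {Ω : Opens V} {m : ℕ}

/-- **The support theorem for locally rectifiable currents** (the case `S = 0` of Federer's
4.1.20 for the integral flat chains `𝓕_m`): a locally rectifiable current `T = (𝓗ᵐ ⌞ W) ∧ θ ξ`
whose support is `𝓗ᵐ`-null is zero, since `‖T‖ = |θ| 𝓗ᵐ ⌞ W ≪ 𝓗ᵐ` lives on `spt T`.
[cite: Federer1969, 4.1.20 with 4.1.28 (4)] -/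
theorem Current.IsLocallyRectifiable.eq_zero_of_measure_support_eq_zero {T : Current Ω m}
    (hT : T.IsLocallyRectifiable) (h0 : (μHE[m] : Measure V) T.support = 0) : T = 0 := by
  obtain ⟨W, θ, ξ, -, rfl⟩ := hT
  refine vectorCurrent_eq_zero_of_measure_support_eq_zero (nonpos_iff_eq_zero.1 ?_)
  calc ((μHE[m] : Measure V).restrict W) (currentOfIntegration W θ ξ : Current Ω m).support
      ≤ (μHE[m] : Measure V) (currentOfIntegration W θ ξ : Current Ω m).support :=
        Measure.le_iff'.1 Measure.restrict_le_self _
    _ = 0 := h0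

/-- **The support theorem for rectifiable currents**: a rectifiable current with `𝓗ᵐ`-null
support is zero. [cite: Federer1969, 4.1.20 with 4.1.28 (4)] -/
theorem Current.IsRectifiable.eq_zero_of_measure_support_eq_zero {T : Current Ω m}
    (hT : T.IsRectifiable) (h0 : (μHE[m] : Measure V) T.support = 0) : T = 0 :=
  hT.1.eq_zero_of_measure_support_eq_zero h0

/-- Above the dimension of the ambient space the Euclidean Hausdorff measure vanishes:
`𝓗ᵈ = 0` on `V` if `dim V < d` (Mathlib: `dimH V = dim V` and `𝓗ᵈ(s) = 0` for `dimH s < d`).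
[folklore] -/
theorem euclideanHausdorffMeasure_eq_zero_of_finrank_lt {d : ℕ} (hd : Module.finrank ℝ V < d) :
    (μHE[d] : Measure V) = 0 := by
  have h1 : dimH (univ : Set V) < (d : ℝ≥0) := by
    rw [Real.dimH_univ_eq_finrank]
    exact_mod_cast hd
  have h2 := hausdorffMeasure_of_dimH_lt h1
  rw [NNReal.coe_natCast, Measure.measure_univ_eq_zero] at h2
  rw [Measure.euclideanHausdorffMeasure_def, h2, smul_zero]

/-- Above the ambient dimension every locally rectifiable current is zero (its carrying measure
`𝓗ᵐ ⌞ W` is the zero measure). [folklore] -/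
theorem Current.IsLocallyRectifiable.eq_zero_of_finrank_lt {T : Current Ω m}
    (hT : T.IsLocallyRectifiable) (hm : Module.finrank ℝ V < m) : T = 0 := by
  obtain ⟨W, θ, ξ, -, rfl⟩ := hT
  have h0 : ((μHE[m] : Measure V).restrict W) = 0 := by
    rw [euclideanHausdorffMeasure_eq_zero_of_finrank_lt hm, Measure.restrict_zero]
  have hli : LocallyIntegrableOn (fun x => (θ x : ℝ) • frameVector (ξ x)) (Ω : Set V)
      ((μHE[m] : Measure V).restrict W) := by
    rw [h0]
    refine fun x _ => ⟨univ, univ_mem, ?_⟩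
    rw [IntegrableOn, Measure.restrict_univ]
    exact integrable_zero_measure
  ext φ
  rw [currentOfIntegration, vectorCurrent_apply hli, h0, integral_zero_measure]
  rfl

/-- **Federer's support theorem for integral flat chains in codimension `≤ 0`.** If
`dim V ≤ m + 1`, an integral flat chain `T = R + ∂S ∈ 𝓕_{m+1}(Ω)` with `𝓗^{m+1}(spt T) = 0`
vanishes: the rectifiable `(m+2)`-current `S` is zero because `𝓗^{m+2} = 0` on `V`, and `T = R`
is rectifiable. This is the statement of `Federer1969_support_integralFlatChain` under the extra
hypothesis `dim V ≤ m + 1`. [cite: Federer1969, 4.1.20 (with 4.1.24, 4.1.28)] -/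
theorem Federer1969_support_integralFlatChain_of_finrank_le (Ω : Opens V) (m : ℕ)
    (hV : Module.finrank ℝ V ≤ m + 1) (T : Current Ω (m + 1)) (hT : T.IsIntegralFlatChain)
    (h0 : (μHE[m + 1] : Measure V) T.support = 0) : T = 0 := by
  obtain ⟨R, S, hR, hS, rfl⟩ := hT
  have hS0 : S = 0 := hS.1.eq_zero_of_finrank_lt (by omega)
  rw [hS0, Current.boundary_zero, add_zero] at h0 ⊢
  exact hR.eq_zero_of_measure_support_eq_zero h0

end Rectifiable

end Literature.Geometry.GeometricMeasureTheory
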